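import Summits.QuantumFields.BalabanUV.Beta.EriceRemainderEnclosureHistoryAutonomyComparisonWitness
import Summits.QuantumFields.BalabanUV.Beta.EriceRemainderEnclosureHistoryAutonomyMonotoneGeneral

/-!
# EriceRemainderEnclosureHistoryAutonomyComparisonWitnessUnique — (E49e) THE ISOTONE WITNESS IS UNIQUELY SOLVABLE ON BOTH SIDES; THE UNIVERSALLY CLOSED
# REFUTATION: (E49b)'s functionals `B_M(u) = 1 + M·max(4 − 1∕u₁², 0) ≤ B′ = B_M + ε·min(max(8∕u₀² − 17, 0), 1)` have, from the pin `1`, EXACTLY ONE box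
# solution each (`0 ≤ M ≤ 1∕7`, `0 ≤ ε < 1∕8`) — `B_M` by (E43b)'s isotone class BY NAME, `B′` by hand (the floor forces levels `≥ 1 + j`, hence memory
# silent and switch on from scale 1, and at scale 0 a scalar equation with ONE root since `8ε < 1`) — so (E49b)'s `h_M(1) < h′(1)` is a failure of
# comparison between THE solutions, not an artefact of non-uniqueness; universally closed: «`B` isotone, zeroth moment `M₀`, floor `b`, `M₀·γ < b`,
# `B ≤ B′`, both uniquely solvable from `p` ⟹ `h′ ≤ h` at every scale» is FALSE (`M = 1∕20`, `ε = 1∕10`, scale 1)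

Cell `pub-balaban`, β-function sub-cell, BINDER row D4 «RemainderConst leaves for Bałaban's split» (`HOME/BINDER-OWNERS.md`; owner lineage `b2b-balaban-beta-an4`;
this file by co-owner #2 lineage `b2b-balaban-beta-d4-p2`, generation 46), β-FLOW TEAM duty (1), FREEZE (0) honoured (def-free; (E49b)'s lemmas on the memory map,
the switch, the functionals and the explicit solutions, (E43b)'s `memFlow_unique_of_monotone_zm`, node U2's `MemFlow` ∕ `SeqBox` ∕ `one_div_sqrt_one_div_sq`
BY NAME, nothing restated).  Sequel of (E49b) `…HistoryAutonomyComparisonWitness`; companions (E49a) `…HistoryAutonomyComparison`, (E49c)∕(E49d)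
`…HistoryAutonomyComparisonPerron[Dual]` — with (E49b): COMPARISON IN THE FUNCTIONAL COSTS THE SIGN OF THE MEMORY, NOT ITS SIZE.

HONEST FRAMING (page 1, verbatim and binding).  *"Discharging BetaPertH makes Bałaban's UV stability UNCONDITIONAL — a real constructive-QFT result; it is
NOT the continuum limit and NOT the Clay problem."*  THIS FILE DISCHARGES NOTHING OF THE KIND.  A [folklore] TOY on ]0,1]^ℕ; nothing of Bałaban's (1.22)
or of the sign of his limit functional in its older couplings (NOT PRINTED; [I] p. 298; GAPS G-t4-U2-1∕-2).  Row D4 class UNCHANGED (critical-path width 0;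
instance 0∕1; D4 DISCHARGE NO DATE).  HONEST DEPENDENCY: continuum YM on T⁴ ⇐ BetaPertH ∧ nine spine estimates (0/9 proved); BetaPertH ⇐ (D1) ∧ (D4) ∧
CAP+tail; G-an2-4 gates asym, D1 and NE2/3/4.

WHAT IS PROVED ([folklore]; 0 `def`, 0 sorry).  §1 **`eq_hM_of_memFlow`** ((E43b) BY NAME), **`levels_of_memFlow'`** (any box solution of `B′` from `1` has the
levels of `h′`), **`eq_h'_of_memFlow`**.  §2 **`witness`** (assembled: isotone, zeroth moment `16M`, floors, `B_M ≤ B′`, both box solutions, both unique,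
`h 1 < h′ 1`, `h′ j < h j` for `j ≥ 2`).  §3 **`comparison_false_for_isotone`**.
-/

noncomputable section
open Finset Set

namespace Summit.QuantumFields.BalabanUV.Beta.EriceRemainderEnclosureHistoryAutonomyComparisonWitnessUnique

open Literature.MathematicalPhysics.QuantumFieldTheory.Balaban1983to89
open Literature.MathematicalPhysics.QuantumFieldTheory.Balaban1983to89.T4BetaStationary
open Literature.MathematicalPhysics.QuantumFieldTheory.Balaban1983to89.T4BetaFlowWellPosed
open Summit.QuantumFields.BalabanUV.Beta.EriceRemainderEnclosureHistoryAutonomyMonotoneGeneral (memFlow_unique_of_monotone_zm)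
open Summit.QuantumFields.BalabanUV.Beta.EriceRemainderEnclosureHistoryAutonomyComparisonWitness

variable {M ε : ℝ}

/-! ## §1 Uniqueness: `h_M` by (E43b)'s isotone class BY NAME; `h′_{M,ε}` by hand (the structure of the levels forces it) -/

/-- **`h_M` IS THE ONLY BOX SOLUTION OF `B_M` FROM THE PIN `1`** — (E43b) `memFlow_unique_of_monotone_zm` (isotone memory of ANY size with a
zeroth moment and a floor), BY NAME. [folklore] -/
theorem eq_hM_of_memFlow (hM : 0 ≤ M) {k : ℕ → ℝ} (hk : SeqBox 1 k)
    (hfk : MemFlow (fun w : ℕ → ℝ => 1 + M * max (4 - 1 / w 1 ^ 2) 0) 1 k) :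
    k = fun j : ℕ => 1 / Real.sqrt (if j = 0 then (1 : ℝ) else 1 + j + M / (1 + M)) :=
  memFlow_unique_of_monotone_zm (BM_isotone hM) (BM_zerothMoment hM) (by positivity : (0 : ℝ) ≤ 16 * M) one_pos one_pos
    (fun u _ => one_le_BM hM u) hk (memFlow_hM hM).1 hfk (memFlow_hM hM).2

/-- **THE LEVELS OF ANY BOX SOLUTION OF `B′_{M,ε}` FROM THE PIN `1` ARE THOSE OF `h′_{M,ε}`** (`0 ≤ M ≤ 1∕7`, `0 ≤ ε < 1∕8`).  The floor forces
levels `≥ 1 + j`, so from scale `1` on the memory is silent and the switch is on (`c_{m+1} = c_m + 1 + ε`); at scale `0` the level `c₁` solves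
`c₁ = 2 + M·max(3 − ε − c₁, 0) + ε·switch(c₁)`, whose right side minus `c₁` is strictly decreasing (`8ε < 1`): one root, `2 + M(1−ε)∕(1+M)`.
[folklore] -/
theorem levels_of_memFlow' (hM : 0 ≤ M) (hM7 : M ≤ 1 / 7) (hε : 0 ≤ ε) (hε8 : ε < 1 / 8) {k : ℕ → ℝ}
    (hfk : MemFlow (fun w : ℕ → ℝ => 1 + M * max (4 - 1 / w 1 ^ 2) 0 + ε * min (max (8 / w 0 ^ 2 - 17) 0) 1) 1 k) :
    ∀ j : ℕ, 1 / k j ^ 2 = (if j = 0 then (1 : ℝ) else 1 + j + ((j : ℝ) - 1) * ε + M * (1 - ε) / (1 + M)) := by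
  have hM1 : (0 : ℝ) < 1 + M := by linarith
  set c : ℕ → ℝ := fun j => 1 / k j ^ 2 with hc_def
  have hc0 : c 0 = 1 := by simp [hc_def, hfk.1]
  have hrec : ∀ m, c (m + 1) = c m + (1 + M * max (4 - c (m + 1 + 1)) 0 + ε * min (max (8 * c (m + 1) - 17) 0) 1) := by
    intro m
    have e := hfk.2 m
    simp only [add_zero] at e
    rw [show (8 : ℝ) / k (m + 1) ^ 2 = 8 * (1 / k (m + 1) ^ 2) by ring] at e
    exact e
  -- the floor: levels at least `1 + j`
  have hge : ∀ j : ℕ, 1 + (j : ℝ) ≤ c j := by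
    intro j
    induction j with
    | zero => simp [hc0]
    | succ m ih =>
      rw [hrec m, Nat.cast_succ]
      nlinarith [mul_nonneg hM (le_max_right (4 - c (m + 1 + 1)) 0), mul_nonneg hε (switch_mem (c (m + 1))).1]
  -- from scale 1 on: memory silent, switch on
  have hstep : ∀ m, 1 ≤ m → c (m + 1) = c m + 1 + ε := by
    intro m hm
    have hm' : (1 : ℝ) ≤ m := by exact_mod_cast hm
    have h4 : max (4 - c (m + 1 + 1)) 0 = 0 := by
      refine max_eq_right ?_
      have := hge (m + 1 + 1)
      push_cast at this
      linarith
    have h1 : min (max (8 * c (m + 1) - 17) 0) 1 = 1 := by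
      refine switch_eq_one ?_
      have := hge (m + 1)
      push_cast at this
      linarith
    rw [hrec m, h4, h1]; ring
  -- scale 0: the scalar equation for `c 1`
  set y : ℝ := 2 + M * (1 - ε) / (1 + M) with hy_def
  have hy8 : y ≤ 17 / 8 := by
    rw [hy_def]
    have : M * (1 - ε) / (1 + M) ≤ 1 / 8 := by rw [div_le_iff₀ hM1]; nlinarith
    linarith
  have hgap : 3 - ε - y = (1 - ε) / (1 + M) := by rw [hy_def]; field_simp; ring
  have hc1eq : c 1 = 2 + M * max (3 - ε - c 1) 0 + ε * min (max (8 * c 1 - 17) 0) 1 := by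
    have e := hrec 0
    rw [hc0, show (0 : ℕ) + 1 + 1 = 1 + 1 from rfl, hstep 1 le_rfl] at e
    rw [show (4 : ℝ) - (c 1 + 1 + ε) = 3 - ε - c 1 by ring] at e
    linarith
  have hc1 : c 1 = y := by
    rcases lt_trichotomy (c 1) y with hlt | heq | hgt
    · -- below `y`: switch off, memory at least linear ⟹ `c 1 ≥ y`
      have hsw : min (max (8 * c 1 - 17) 0) 1 = 0 := switch_eq_zero (by linarith)
      have hmx : 3 - ε - c 1 ≤ max (3 - ε - c 1) 0 := le_max_left _ _
      rw [hsw, mul_zero, add_zero] at hc1eq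
      have : y * (1 + M) ≤ c 1 * (1 + M) := by
        rw [hy_def]
        have e : (2 + M * (1 - ε) / (1 + M)) * (1 + M) = 2 + M * (3 - ε) - 2 * M + 2 * M - M * 0 := by field_simp; ring
        nlinarith [mul_le_mul_of_nonneg_left hmx hM]
      exact absurd (le_of_mul_le_mul_right this hM1) (not_le.mpr hlt)
    · exact heq
    · -- above `y`: memory at most `(1−ε)/(1+M)`, switch gains at most slope `8` ⟹ `(c 1 − y)(1 − 8ε) ≤ 0`
      have hmx : max (3 - ε - c 1) 0 ≤ (1 - ε) / (1 + M) :=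
        max_le (by rw [← hgap]; linarith) (div_nonneg (by linarith) hM1.le)
      have hsw : min (max (8 * c 1 - 17) 0) 1 ≤ 8 * (c 1 - y) := by
        have := switch_sub_le hgt.le
        rw [switch_eq_zero hy8, sub_zero] at this
        exact this
      have h1 : c 1 ≤ y + 8 * ε * (c 1 - y) := by
        rw [hc1eq, hy_def]
        have := mul_le_mul_of_nonneg_left hmx hM
        have := mul_le_mul_of_nonneg_left hsw hε
        rw [mul_div_assoc'] at *
        nlinarith
      nlinarith
  -- all levels
  have hall : ∀ m : ℕ, c (m + 1) = 1 + ((m + 1 : ℕ) : ℝ) + (((m + 1 : ℕ) : ℝ) - 1) * ε + M * (1 - ε) / (1 + M) := by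
    intro m
    induction m with
    | zero => rw [hc1, hy_def]; push_cast; ring
    | succ m ih => rw [hstep (m + 1) (by omega), ih]; push_cast; ring
  intro j
  rcases Nat.eq_zero_or_pos j with rfl | hj
  · rw [if_pos rfl]; exact hc0
  · obtain ⟨m, rfl⟩ : ∃ m, j = m + 1 := ⟨j - 1, by omega⟩
    rw [if_neg (Nat.succ_ne_zero m)]
    exact hall m

/-- **`h′_{M,ε}` IS THE ONLY BOX SOLUTION OF `B′_{M,ε}` FROM THE PIN `1`** (`0 ≤ M ≤ 1∕7`, `0 ≤ ε < 1∕8`). [folklore] -/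
theorem eq_h'_of_memFlow (hM : 0 ≤ M) (hM7 : M ≤ 1 / 7) (hε : 0 ≤ ε) (hε8 : ε < 1 / 8) {k : ℕ → ℝ} (hk : SeqBox 1 k)
    (hfk : MemFlow (fun w : ℕ → ℝ => 1 + M * max (4 - 1 / w 1 ^ 2) 0 + ε * min (max (8 / w 0 ^ 2 - 17) 0) 1) 1 k) :
    k = fun j : ℕ => 1 / Real.sqrt (if j = 0 then (1 : ℝ) else 1 + j + ((j : ℝ) - 1) * ε + M * (1 - ε) / (1 + M)) := by
  funext j
  rw [← levels_of_memFlow' hM hM7 hε hε8 hfk j, one_div_sqrt_one_div_sq (hk j).1]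

/-! ## §2 The witness, assembled -/

/-- **THE WITNESS, ASSEMBLED** (`0 < M ≤ 1∕7`, `0 < ε < 1∕8`): two functionals `B_M ≤ B′_{M,ε}` on the box ]0,1], both with floor `1`; `B_M`
ISOTONE with zeroth moment `16·M` (as small as desired — inside every well-posedness class of the lineage for `M < 1∕16`); each with EXACTLY ONE
box solution from the pin `1`; and the solution of the LARGER functional is STRICTLY LARGER at scale `1`. [folklore] -/
theorem witness (hM : 0 < M) (hM7 : M ≤ 1 / 7) (hε : 0 < ε) (hε8 : ε < 1 / 8) :
    ∃ (B B' : (ℕ → ℝ) → ℝ) (h h' : ℕ → ℝ),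
      (∀ u v : ℕ → ℝ, SeqBox 1 u → SeqBox 1 v → (∀ j, u j ≤ v j) → B u ≤ B v) ∧
      (∀ u u' : ℕ → ℝ, SeqBox 1 u → SeqBox 1 u' → ∀ D : ℝ, (∀ j, |u j - u' j| ≤ D) → |B u - B u'| ≤ 16 * M * D) ∧
      (∀ u, SeqBox 1 u → 1 ≤ B u) ∧ (∀ u, SeqBox 1 u → 1 ≤ B' u) ∧ (∀ u, SeqBox 1 u → B u ≤ B' u) ∧
      SeqBox 1 h ∧ MemFlow B 1 h ∧ SeqBox 1 h' ∧ MemFlow B' 1 h' ∧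
      (∀ w : ℕ → ℝ, SeqBox 1 w → MemFlow B 1 w → w = h) ∧ (∀ w : ℕ → ℝ, SeqBox 1 w → MemFlow B' 1 w → w = h') ∧
      h 1 < h' 1 ∧ ∀ j, 2 ≤ j → h' j < h j := by
  refine ⟨fun w : ℕ → ℝ => 1 + M * max (4 - 1 / w 1 ^ 2) 0,
    fun w : ℕ → ℝ => 1 + M * max (4 - 1 / w 1 ^ 2) 0 + ε * min (max (8 / w 0 ^ 2 - 17) 0) 1,
    fun j : ℕ => 1 / Real.sqrt (if j = 0 then (1 : ℝ) else 1 + j + M / (1 + M)),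
    fun j : ℕ => 1 / Real.sqrt (if j = 0 then (1 : ℝ) else 1 + j + ((j : ℝ) - 1) * ε + M * (1 - ε) / (1 + M)),
    BM_isotone hM.le, BM_zerothMoment hM.le, fun u _ => one_le_BM hM.le u, fun u _ => one_le_B' hM.le hε.le u,
    fun u _ => BM_le_B' hε.le u, (memFlow_hM hM.le).1, (memFlow_hM hM.le).2, (memFlow_h' hM.le hM7 hε.le (by linarith)).1,
    (memFlow_h' hM.le hM7 hε.le (by linarith)).2, fun w hw hfw => eq_hM_of_memFlow hM.le hw hfw,
    fun w hw hfw => eq_h'_of_memFlow hM.le hM7 hε.le hε8 hw hfw, hM_one_lt_h'_one hM hε (by linarith),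
    fun j hj => h'_lt_hM_of_two_le hM hε hj⟩

/-! ## §3 The universally closed refutation: without the antitone sign, comparison in the functional is FALSE -/

/-- **COMPARISON IN THE FUNCTIONAL IS FALSE FOR ISOTONE MEMORY — EVEN INSIDE THE WELL-POSEDNESS CLASS `M₀·γ < b`.**  The statement «`B`
isotone with zeroth moment `M₀`, floor `b`, `M₀·γ < b`; `B ≤ B′` on the box ]0,γ], `B′` with floor `b`; both flows uniquely solvable from the pin
`p`; then the box solutions satisfy `h′ ≤ h` at every scale», universally closed, is REFUTED by `M = 1∕20` (`M₀ = 4∕5 < 1 = b = γ = p`),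
`ε = 1∕10`, scale `1`.  Compare (E49a) `…HistoryAutonomyComparison.le_of_functional_le` ∕ (E49c) `…ComparisonPerron.le_of_functional_le`:
with `B` ANTITONE (in all, resp. in the older couplings) the same conclusion HOLDS — the sign of the memory decides, not its size. [folklore] -/
theorem comparison_false_for_isotone :
    ¬ ∀ (B B' : (ℕ → ℝ) → ℝ) (γ b M₀ p : ℝ) (h h' : ℕ → ℝ), 0 < γ → 0 < b → 0 ≤ M₀ → M₀ * γ < b → 0 < p → p ≤ γ →
        (∀ u v : ℕ → ℝ, SeqBox γ u → SeqBox γ v → (∀ j, u j ≤ v j) → B u ≤ B v) →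
        (∀ u u' : ℕ → ℝ, SeqBox γ u → SeqBox γ u' → ∀ D : ℝ, (∀ j, |u j - u' j| ≤ D) → |B u - B u'| ≤ M₀ * D) →
        (∀ u, SeqBox γ u → b ≤ B u) → (∀ u, SeqBox γ u → b ≤ B' u) → (∀ u, SeqBox γ u → B u ≤ B' u) →
        (∀ w w' : ℕ → ℝ, SeqBox γ w → SeqBox γ w' → MemFlow B p w → MemFlow B p w' → w = w') →
        (∀ w w' : ℕ → ℝ, SeqBox γ w → SeqBox γ w' → MemFlow B' p w → MemFlow B' p w' → w = w') →
        SeqBox γ h → MemFlow B p h → SeqBox γ h' → MemFlow B' p h' → ∀ j, h' j ≤ h j := by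
  intro H
  obtain ⟨B, B', h, h', hiso, hzm, hlo, hlo', hBB', hh, hf, hh', hf', huniq, huniq', hlt, -⟩ :=
    witness (M := 1 / 20) (ε := 1 / 10) (by norm_num) (by norm_num) (by norm_num) (by norm_num)
  have := H B B' 1 1 (16 * (1 / 20)) 1 h h' one_pos one_pos (by norm_num) (by norm_num) one_pos le_rfl hiso hzm hlo hlo' hBB'
    (fun w w' hw hw' hfw hfw' => (huniq w hw hfw).trans (huniq w' hw' hfw').symm)
    (fun w w' hw hw' hfw hfw' => (huniq' w hw hfw).trans (huniq' w' hw' hfw').symm) hh hf hh' hf' 1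
  exact absurd this (not_le.mpr hlt)

end Summit.QuantumFields.BalabanUV.Beta.EriceRemainderEnclosureHistoryAutonomyComparisonWitnessUnique

end
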